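import Summits.MatrixMultiplication.OmegaCensus.STPPVosperSlackTwoLawABQ

/-!
# ω-census (abelian STPP census): `{(3,3,3),(3,3,4)} ⊄ ℤ₆₁` — slack-2 partition law, CASE B′ rows up to dihedral symmetry, part 8 (kernel computations)

HONEST FRAMING (pub-omega census; verbatim): lottery ticket; floor = certified bounds/negative ranges.
Census STRUCTURE (seat pub-omega-stpp-2 gen 27, 2026-08-28), family (b2).  Rows for the kill of the leaf `{(3,3,3),(3,3,4)} @ ℤ₆₁` by the slack-2
partition law (stpp-1 lineage: shapes `STPPVosperSlackTwoShapes.lean`, checker `caseADeadQ'` of `STPPVosperSlackTwoCheckers.lean`, soundness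
`caseADeadQ'_false_of_isAP`; row interface `slack_two_caseC_of_rowsQ` of `STPPVosperSlackTwoLawABQ.lean`): reading `(a, b, c) = (4, 3, 3)` of the block
`(3,3,4)`, the other block `(3, 3, 3)`, `L = z = 9`.  Case B′ = case A of the role-swapped family `(B, A, C)` (free shape = the 4-set `Aᵢ`): rows `caseADeadQ' 61 3 3 9 9 3 3 3 Q` over the 34 220 four-shapes.  For each index chunk `[lo, hi)` of `qShapes 61 4 lo hi` ONE `decide +kernel` certifies, shape by
shape, either `dihedralSmaller 61 Q` (the shape is not the minimal-mask representative of its dihedral orbit — no checker run) or `caseADeadQ' 61 3 3 9 9 3 3 3 Q`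
(the checker finds no STPP family).  Chunk boundaries balance the python cost mirror (HOME `pub-omega-stpp-2-g27/code/costA.py`); 4495 representatives
in all.  Assembly in `STPPVosperSlackTwoRows61BAsm.lean`.  Nothing here is progress on `ω`.

References: H. Cohn, R. Kleinberg, B. Szegedy, C. Umans, FOCS 2005 (arXiv:math/0511460), Def. 5.1; A. G. Vosper, J. London Math. Soc. 31 (1956).
-/

namespace Summit.MatrixMultiplication.OmegaCensus.CubeNB.S2

/-- Case B′ rows, shape indices `[30776, 31556)`: each shape is non-representative or certified dead. [folklore] -/
theorem rowsB61_c28 : ((qShapes 61 4 30776 31556).all fun Q => dihedralSmaller 61 Q || caseADeadQ' 61 3 3 9 9 3 3 3 Q) = true := by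
  decide +kernel

/-- Case B′ rows, shape indices `[31556, 31797)`: each shape is non-representative or certified dead. [folklore] -/
theorem rowsB61_c29 : ((qShapes 61 4 31556 31797).all fun Q => dihedralSmaller 61 Q || caseADeadQ' 61 3 3 9 9 3 3 3 Q) = true := by
  decide +kernel

/-- Case B′ rows, shape indices `[31797, 32030)`: each shape is non-representative or certified dead. [folklore] -/
theorem rowsB61_c30 : ((qShapes 61 4 31797 32030).all fun Q => dihedralSmaller 61 Q || caseADeadQ' 61 3 3 9 9 3 3 3 Q) = true := by
  decide +kernel

/-- Case B′ rows, shape indices `[32030, 32275)`: each shape is non-representative or certified dead. [folklore] -/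
theorem rowsB61_c31 : ((qShapes 61 4 32030 32275).all fun Q => dihedralSmaller 61 Q || caseADeadQ' 61 3 3 9 9 3 3 3 Q) = true := by
  decide +kernel

end Summit.MatrixMultiplication.OmegaCensus.CubeNB.S2
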